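import Literature.Analysis.FluidPDE.JetSupSummary
import Literature.Analysis.FluidPDE.JetF1Estimate
import Literature.Analysis.FluidPDE.MollifiedNSRTripleBounds
import Literature.Analysis.FunctionSpaces.TorusRieszTransformProofs
import HarnessLib

/-!
# The intermittent-jet convex-integration step for Navier–Stokes–Reynolds triples (BV §7, assembled)

Analysis/FluidPDE support file (everything proved): one step of the Buckmaster–Vicol
intermittent convex-integration scheme for the Navier–Stokes–Reynolds system on `[0,T] × 𝕋³`
in the jet-based form of the survey (Buckmaster–Vicol, EMS Surv. Math. Sci. 6 (2019), §7), with
ALL parameters symbolic: from a classical NSR triple `(v, p, R)` with `C¹` bounds of `v`, sup and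
`L¹` bounds of `R`, and parameters `(γ₀, ℓ, σ, κ, μ, μ′)`, the step produces (space-time
mollification `MollifiedNSRTripleBounds` + jet perturbation `JetPerturbation` +
`NSRPerturbationVisc`) a new classical NSR triple `(v', p', R')` with zero-mean `v'`, together
with explicit algebraic bounds of `‖v' - v‖_{L²}`, `‖R'‖_{L¹}`, `sup‖R'‖` and the `C¹` size of
`v'` in terms of the parameters and of finitely many absolute constants (`StepConsts`). The
choice of the parameters as powers of `λ_{q+1}` and the verification of the inductive estimates
is done separately (pure arithmetic).

## References

* T. Buckmaster, V. Vicol, EMS Surv. Math. Sci. 6 (2019) = arXiv:1901.09023, §7.5–7.7. [`BuckmasterVicol2020`]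
* T. Buckmaster, V. Vicol, Ann. of Math. 189 (2019) = arXiv:1709.10033, §2. [`BuckmasterVicol2019Annals`]
-/

noncomputable section

open MeasureTheory Set Filter Topology Function
open scoped InnerProductSpace ContDiff ENNReal NNReal

namespace Literature.Analysis.FluidPDE

namespace JetStep

open Literature.Analysis.FunctionSpaces FunctionSpaces.Torus Mikado NashGeometric Jet

local notation "𝕋³" => UnitAddTorus (Fin 3)
local notation "E³" => EuclideanSpace ℝ (Fin 3)
local notation "Idx" => Index (Fin 3)

/-! ## Constants and parameters -/

/-- The absolute constants of the step. [folklore] -/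
structure StepConsts where
  /-- mollification package constant -/
  Cp : ℝ
  /-- amplitude constant -/
  Ca : ℝ
  /-- jet-bounds constant -/
  B : ℝ
  /-- second pipe-derivative constant -/
  Cψ : ℝ
  /-- `L²` Hessian constant -/
  C₂ : ℝ
  /-- Morrey constant -/
  K : ℝ
  /-- `∇Δ⁻¹` sup constant -/
  K₁ : ℝ
  /-- `ℛ` on `L¹` -/
  C₁ : ℝ
  /-- `ℛ div` on `L^{33/32}` -/
  Cℛ : ℝ
  /-- `ℛ` on `L^∞` -/
  Kℛ : ℝ

/-- Admissible constants. [folklore] -/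
structure StepConsts.Valid (c : StepConsts) : Prop where
  hCp : 1 ≤ c.Cp
  hCa : 0 ≤ c.Ca
  hB : 1 ≤ c.B
  hCψ : 0 ≤ c.Cψ
  hC₂ : 0 ≤ c.C₂
  hK : 0 ≤ c.K
  hK₁ : 0 ≤ c.K₁
  hC₁ : 0 ≤ c.C₁
  hCℛ : 0 ≤ c.Cℛ
  hKℛ : 0 ≤ c.Kℛ

/-- The parameters of one step. [folklore] -/
structure StepPars where
  /-- time horizon -/
  T : ℝ
  /-- `C¹` size of `v` -/
  V : ℝ
  /-- sup size of `R` -/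
  A : ℝ
  /-- `L¹` size of `R` -/
  δ : ℝ
  /-- amplitude floor -/
  γ₀ : ℝ
  /-- mollification length -/
  ℓ : ℝ
  /-- cell frequency -/
  σ : ℕ
  /-- axial concentration -/
  κ : ℝ
  /-- transverse concentration -/
  μ : ℝ
  /-- temporal frequency scale `μ′` -/
  mup : ℝ

/-- Admissible parameters. [folklore] -/
structure StepPars.Valid (P : StepPars) : Prop where
  hT : 0 < P.T
  hV : 1 ≤ P.V
  hA : 1 ≤ P.A
  hδ : 0 < P.δ
  hγ : 0 < P.γ₀
  hℓ : 0 < P.ℓ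
  hℓ4 : P.ℓ ≤ 1 / 4
  hℓT : 8 * P.ℓ ≤ P.T
  hσ : 0 < P.σ
  hκ : 1 ≤ P.κ
  hμ : pipeConc ≤ P.μ
  hmup : 0 < P.mup

namespace StepPars

/-- The parameter datum (only `σ, κ, μ, μ′` are read by the size functions). [folklore] -/
def D (P : StepPars) : Datum := ⟨1, 1, fun _ _ _ => 0, P.μ, P.κ, P.σ, P.mup, fun _ => 0⟩

variable (c : StepConsts) (P : StepPars)

/-- `Y = max(1, C_p A / γ₀)`. [folklore] -/
def Y : ℝ := max 1 (c.Cp * P.A / P.γ₀)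
/-- `Θ = ℓ⁻¹`. [folklore] -/
def Θ : ℝ := P.ℓ⁻¹
/-- `A₀ = C_a (γ₀Y)^{1/2}`. [folklore] -/
def A₀ : ℝ := c.Ca * Real.sqrt (P.γ₀ * P.Y c)
/-- `A₁`. [folklore] -/
def A₁ : ℝ := c.Ca * Real.sqrt P.γ₀ * P.Y c ^ 2 * P.Θ
/-- `A₂`. [folklore] -/
def A₂ : ℝ := c.Ca * Real.sqrt P.γ₀ * P.Y c ^ 4 * P.Θ ^ 2
/-- `H₁`. [folklore] -/
def H₁ : ℝ := c.Ca * P.γ₀ * P.Y c ^ 2 * P.Θ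
/-- `H₂`. [folklore] -/
def H₂ : ℝ := c.Ca * P.γ₀ * P.Y c ^ 4 * P.Θ ^ 2

/-- `∫‖wp‖² ≤ Ep`. [folklore] -/
def Ep : ℝ := NN * (5 * (2 / radius (Fin 3) * (P.γ₀ + 3 * (c.Cp * P.δ)) + 3 * P.H₁ c * (Real.sqrt 3 / P.σ)))
/-- `∫‖wp‖ ≤ Lp`. [folklore] -/
def Lp : ℝ := NN * (3 * P.A₀ c * (c.B * P.κ ^ (-(1 / 2 : ℝ)) * P.μ⁻¹))
/-- `sup‖wpc - wp‖ ≤ Sc`. [folklore] -/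
def Sc : ℝ := P.D.wcSup (P.A₀ c) (P.A₁ c) c.B
/-- `∫‖wpc - wp‖ ≤ Lc`. [folklore] -/
def Lc : ℝ := NN * (3 * (c.B * (5 * P.A₀ c * (P.κ ^ (1 / 2 : ℝ) * P.μ ^ (-(2 : ℝ))) +
      36 * P.A₁ c * (P.κ ^ (-(1 / 2 : ℝ)) * (P.σ : ℝ)⁻¹ * P.μ ^ (-(2 : ℝ))))))
/-- `∫‖X‖² ≤ EX`. [folklore] -/
def EX : ℝ := NN * (NN * (9 * (P.mup⁻¹) ^ 2 * (P.A₀ c ^ 4 * (c.B * P.κ * P.μ ^ 2))))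
/-- `‖∂ᵢζ‖_{L²} ≤ Z`. [folklore] -/
def Z : ℝ := 3 * (c.C₂ * (2 * Real.sqrt (P.EX c)))
/-- `∫‖∇ζ‖² ≤ Eζ`. [folklore] -/
def Eζ : ℝ := 3 * P.Z c ^ 2
/-- `∫‖wr‖² ≤ Er`. [folklore] -/
def Er : ℝ := 3 * (P.Sc c * P.Lc c + P.EX c + P.Eζ c)
/-- `∫‖∂ᵢwpc‖ ≤ LdW`. [folklore] -/
def LdW : ℝ := NN *
      (3 * P.A₁ c * (c.B * P.κ ^ (-(1 / 2 : ℝ)) * P.μ⁻¹) + 9 * P.σ * P.A₀ c * (c.B * P.κ ^ (1 / 2 : ℝ) * P.μ⁻¹) +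
       3 * P.A₀ c * (c.B * P.σ * P.κ ^ (-(1 / 2 : ℝ))) + 41 * P.σ * P.A₁ c * (3 * (c.B * P.κ ^ (1 / 2 : ℝ) * (P.σ : ℝ)⁻¹ * P.μ ^ (-(2 : ℝ)))) +
       15 * P.σ ^ 2 * P.A₀ c * (3 * (c.B * P.κ ^ (3 / 2 : ℝ) * (P.σ : ℝ)⁻¹ * P.μ ^ (-(2 : ℝ)))) +
       5 * P.σ * P.A₀ c * (3 * (c.B * P.κ ^ (1 / 2 : ℝ) * P.μ⁻¹)) + 12 * P.A₁ c * (3 * (c.B * P.κ ^ (-(1 / 2 : ℝ)) * P.μ⁻¹)) +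
       12 * P.A₂ c * (3 * (c.B * P.κ ^ (-(1 / 2 : ℝ)) * (P.σ : ℝ)⁻¹ * P.μ ^ (-(2 : ℝ)))))
/-- `∫‖∂ᵢX‖ ≤ LdX`. [folklore] -/
def LdX : ℝ := NN * (3 * P.mup⁻¹ * (P.H₁ c + P.A₀ c ^ 2 * (c.B * (6 * P.σ * P.κ + 2 * P.σ * P.μ))))
/-- `∫‖S_osc‖ ≤ LS`. [folklore] -/
def LS : ℝ := NN * (2 * (27 * P.H₁ c) * (3 * (c.B * (P.σ : ℝ)⁻¹)))
/-- `∫‖f₂‖ ≤ Lf₂`. [folklore] -/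
def Lf₂ : ℝ := NN * ((2 * 3 + 1) * (27 * P.H₂ c) * (3 * (c.B * (P.σ : ℝ)⁻¹)))
/-- `∫‖f₃‖ ≤ Lf₃`. [folklore] -/
def Lf₃ : ℝ := NN * (3 * P.mup⁻¹ * P.H₁ c)
/-- `∫‖ℛf₁‖ ≤ Lf₁` (`p = 33/32`). [folklore] -/
def Lf₁ : ℝ := NN * (c.Cℛ * (3 * (3 * (6 * P.A₁ c * P.D.Keta c.B (33 / 32) + 30 * P.σ * P.mup * P.A₀ c * P.D.KetaD c.B (33 / 32)))))
/-- The `L²` increment bound. [folklore] -/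
def stepInc : ℝ := c.Cp * (P.V + P.V) * P.ℓ + Real.sqrt (P.Ep c) + Real.sqrt (P.Er c)
/-- The `L¹` stress bound. [folklore] -/
def stepL1 : ℝ :=
  2 * (c.Cp * (P.V + 1 / P.T) * (P.V + P.V) * P.ℓ + (2 * (Real.sqrt (P.Ep c) * Real.sqrt (P.Er c)) + P.Er c) + P.LS c) +
    4 * (c.Cp * P.V) * (P.Lp c + P.Lc c + Real.sqrt (P.EX c) + Real.sqrt (P.Eζ c)) + 4 * (3 * (P.LdW c + P.LdX c)) +
    (P.Lf₁ c + c.C₁ * (2 * (P.Lf₂ c + P.Lf₃ c)))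
/-- `sup‖w‖`. [folklore] -/
def Sw : ℝ := P.D.wSup (P.A₀ c) (P.A₁ c) (P.H₁ c) c.B c.K
/-- `sup‖wp‖`. [folklore] -/
def Sp : ℝ := P.D.wpSup (P.A₀ c) c.B
/-- `sup‖∂ᵢw'‖`. [folklore] -/
def Sd : ℝ := P.D.dwpcSup (P.A₀ c) (P.A₁ c) (P.A₂ c) c.B + P.D.dXSup (P.A₀ c) (P.H₁ c) c.B
/-- `sup|η²ψ̃² - 1|`. [folklore] -/
def Φ : ℝ := P.D.fastSup c.B + 1
/-- `sup‖S_osc‖`. [folklore] -/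
def SS : ℝ := NN * (2 * (27 * P.H₁ c) * (3 * (c.K₁ * P.Φ c)))
/-- `sup‖f‖`. [folklore] -/
def Sf : ℝ := P.D.dtwpcSup (P.A₀ c) (P.A₁ c) (P.A₂ c) c.B + NN * ((2 * 3 + 1) * (27 * P.H₂ c) * (3 * (c.K₁ * P.Φ c))) +
  NN * (3 * P.mup⁻¹ * (P.H₁ c * (P.Φ c + 1))) + (P.Lf₂ c + P.Lf₃ c)
/-- The sup stress bound. [folklore] -/
def stepSup : ℝ :=
  2 * (c.Cp * (P.V + 1 / P.T) * (P.V + P.V) * P.ℓ + (2 * (P.Sp c * (P.Sw c + P.Sp c)) + (P.Sw c + P.Sp c) ^ 2) + P.SS c) +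
    4 * (c.Cp * P.V * P.Sw c) + 4 * (3 * P.Sd c) + c.Kℛ * P.Sf c
/-- `sup‖v'‖`. [folklore] -/
def stepC0 : ℝ := c.Cp * P.V + P.Sw c
/-- `sup‖∂ᵢv'‖`. [folklore] -/
def stepC1 : ℝ := c.Cp * (P.V + P.V) + P.D.dwSup (P.A₀ c) (P.A₁ c) (P.A₂ c) (P.H₁ c) (P.H₂ c) c.B c.Cψ c.K
/-- `sup‖∂ₜv'‖`. [folklore] -/
def stepCt : ℝ := c.Cp * (P.V + P.V) + P.D.dtwSup (P.A₀ c) (P.A₁ c) (P.A₂ c) (P.H₁ c) (P.H₂ c) c.B c.K₁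

end StepPars

/-! ## The step -/

set_option maxHeartbeats 4000000 in
/-- **The jet-based convex-integration step for Navier–Stokes–Reynolds triples** (BV §7.5–7.7,
with symbolic parameters): from a classical NSR triple with the displayed bounds, a new classical
NSR triple with the displayed algebraic bounds. [cite: BuckmasterVicol2020, §7.5–7.7] -/
theorem jet_step : ∃ c : StepConsts, c.Valid ∧
    ∀ (P : StepPars) (ν : ℝ) (v : ℝ → 𝕋³ → E³) (p : ℝ → 𝕋³ → ℝ) (R : ℝ → 𝕋³ → Fin 3 → E³),
    P.Valid → 0 < ν → ν ≤ 1 → Torus.IsNSReynoldsOn (Icc 0 P.T) ν v p R → (∀ t ∈ Icc 0 P.T, Torus.HasZeroMean (v t)) →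
    (∀ t ∈ Icc 0 P.T, ∀ y, ‖v t y‖ ≤ P.V) → (∀ i, ∀ t ∈ Icc 0 P.T, ∀ y, ‖Torus.partialDeriv i (v t) y‖ ≤ P.V) →
    (∀ t ∈ Icc 0 P.T, ∀ y, ‖Torus.timeDerivWithin (Icc 0 P.T) v t y‖ ≤ P.V) →
    (∀ t ∈ Icc 0 P.T, ∀ y, ‖R t y‖ ≤ P.A) → (∀ t ∈ Icc 0 P.T, ∫ y, ‖R t y‖ ≤ P.δ) →
    ∃ (v' : ℝ → 𝕋³ → E³) (p' : ℝ → 𝕋³ → ℝ) (R' : ℝ → 𝕋³ → Fin 3 → E³),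
      Torus.IsNSReynoldsOn (Icc 0 P.T) ν v' p' R' ∧ (∀ t ∈ Icc 0 P.T, Torus.HasZeroMean (v' t)) ∧
      (∀ t ∈ Icc 0 P.T, eLpNorm (v' t - v t) 2 volume ≤ ENNReal.ofReal (P.stepInc c)) ∧
      (∀ t ∈ Icc 0 P.T, ∫ y, ‖R' t y‖ ≤ P.stepL1 c) ∧
      (∀ t ∈ Icc 0 P.T, ∀ y, ‖R' t y‖ ≤ P.stepSup c) ∧
      (∀ t ∈ Icc 0 P.T, ∀ y, ‖v' t y‖ ≤ P.stepC0 c) ∧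
      (∀ t ∈ Icc 0 P.T, ∀ y i, ‖Torus.partialDeriv i (v' t) y‖ ≤ P.stepC1 c) ∧
      (∀ t ∈ Icc 0 P.T, ∀ y, ‖Torus.timeDerivWithin (Icc 0 P.T) v' t y‖ ≤ P.stepCt c) := by
  -- the absolute constants
  obtain ⟨Cp, hCp1, hpkg⟩ := Torus.exists_mollified_nsr_package (d := Fin 3) Datum.hd3
  obtain ⟨gfam, hgb, hg1, -⟩ := Intermittent.exists_isBump_disjoint (Fin 1)
  set g : ℝ → ℝ := gfam 0 with hgdef
  have hg : Intermittent.IsBump g := hgb 0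
  have hgn : ∫ s in (0 : ℝ)..1, g s ^ 2 = 1 := hg1 0
  obtain ⟨B, hB1, hBall⟩ := Jet.exists_bounds hg
  obtain ⟨Cψ, hCψ1, hCψ⟩ := Jet.exists_ddpsi_const
  obtain ⟨C₂, hC₂⟩ := FunctionSpaces.Torus.eLpNorm_hessian_le_laplacian_holds (d := Fin 3) 2 (by norm_num) (by norm_num)
  obtain ⟨K, hK⟩ := FunctionSpaces.Torus.exists_enorm_partialDeriv_partialDeriv_le (d := Fin 3)
  obtain ⟨K₁, hK₁⟩ := FunctionSpaces.Torus.exists_enorm_partialDeriv_invLaplacian_le (d := Fin 3)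
  obtain ⟨C₁, hC₁⟩ := Torus.exists_eLpNorm_antidivergence_le (d := Fin 3) Datum.hd3 (p := 1) le_rfl
  have hp33 : (1 : ℝ≥0∞) < ENNReal.ofReal (33 / 32) := by
    rw [← ENNReal.ofReal_one]; exact (ENNReal.ofReal_lt_ofReal_iff (by norm_num)).2 (by norm_num)
  obtain ⟨Cℛ, hCℛ⟩ := Torus.exists_eLpNorm_antidivergence_tensorDivergence_le (d := Fin 3) Datum.hd3 hp33 ENNReal.ofReal_lt_top
  obtain ⟨Kℛ, hKℛ0, hKℛ⟩ := Torus.exists_norm_antidivergence_le (d := Fin 3) Datum.hd3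
  set c : StepConsts := ⟨Cp, JAmp.ampConst (Fin 3), B, Cψ, C₂, K, K₁, C₁, Cℛ, Kℛ⟩ with hcdef
  have hCa0 : 0 ≤ JAmp.ampConst (Fin 3) := by
    have := radius_pos Datum.hd3 (d := Fin 3); unfold JAmp.ampConst; positivity
  refine ⟨c, ⟨hCp1, hCa0, hB1, by linarith, C₂.coe_nonneg, K.coe_nonneg, K₁.coe_nonneg, C₁.coe_nonneg, Cℛ.coe_nonneg, hKℛ0⟩, ?_⟩
  intro P ν v p R hP hν hν1 hns hmean hv hdv htv hRA hRδ
  obtain ⟨hT, hV1, hA1, hδ, hγ, hℓ, hℓ4, hℓT, hσ, hκ1, hμ60, hmup⟩ := hP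
  have hV0 : 0 ≤ P.V := by linarith
  -- Layer 3: mollification
  obtain ⟨vm, pm, Rc, M, hold, hvmmean, hRc, hM, hMsym, hRcsym, hvm0, hvmv, hvm1, hvmt, hRcb, hMδ, hMA, hM1, hM2, hMt, hMt1⟩ :=
    hpkg P.T ν v p R hns hT hmean P.V P.V P.V P.A P.δ P.ℓ hv hdv htv hV0 hV0 hRA hRδ hℓ hℓ4 hℓT
  -- the datum
  set D : Datum := ⟨P.T, P.γ₀, M, P.μ, P.κ, P.σ, P.mup, g⟩ with hDdef
  have hD : D.Valid := ⟨hT, hγ, hM, fun t _ y i j => hMsym t y i j, hμ60, hκ1, hσ, hmup, hg, hgn⟩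
  have hBD : ∀ x t, Jet.Bounds B (D.J x) D.s x t := fun x t => hBall (D.J x) rfl (Datum.Jvalid hD x) D.s x t
  have hCψD : ∀ (x : Idx) (i l : Fin 3) (y : 𝕋³), |Torus.partialDeriv i (Torus.partialDeriv l (Jet.psiJ (D.J x) D.s x)) y| ≤ Cψ * (D.σ : ℝ) ^ 2 * D.μ ^ 3 :=
    fun x i l y => Jet.abs_partialDeriv_partialDeriv_psiJ_le D.s (Datum.Jvalid hD x) hCψ x i l y
  -- the amplitude bounds
  set Y : ℝ := max 1 (Cp * P.A / P.γ₀) with hYdef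
  set Θ : ℝ := P.ℓ⁻¹ with hΘdef
  have hY1 : 1 ≤ Y := le_max_left _ _
  have hΘ1 : 1 ≤ Θ := by rw [hΘdef]; exact one_le_inv_iff₀.2 ⟨hℓ, by linarith⟩
  have hA0' : 0 ≤ P.A := by linarith
  have hD0 : Cp * P.A ≤ P.γ₀ * Y := by
    have : Cp * P.A / P.γ₀ ≤ Y := le_max_right _ _
    rw [div_le_iff₀ hγ] at this; linarith
  have hℓinv : 0 < P.ℓ⁻¹ := inv_pos.2 hℓ
  have hD1 : Cp * P.A * P.ℓ⁻¹ ≤ P.γ₀ * Y * Θ := by rw [hΘdef]; exact mul_le_mul_of_nonneg_right hD0 hℓinv.le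
  have hD2 : Cp * P.A * P.ℓ⁻¹ ^ 2 ≤ P.γ₀ * Y * Θ ^ 2 := by rw [hΘdef]; exact mul_le_mul_of_nonneg_right hD0 (by positivity)
  have hCA0 : 0 ≤ Cp * P.A := by positivity
  have hpack := fun x {t} (ht : t ∈ Icc 0 P.T) y l m => JAmp.jamp_package (d := Fin 3) (γ₀ := P.γ₀) (R := M) Datum.hd3 hγ hM (Datum.uniqueDiffOn hD)
    hY1 hΘ1 hCA0 (by positivity) (by positivity) hD0 hD1 hD2 (fun t _ y => hMA t y) (fun t _ y l => hM1 t y l) hMt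
    (fun t _ y l m' => hM2 t y m' l) hMt1 x ht y l m
  set A₀ : ℝ := JAmp.ampConst (Fin 3) * Real.sqrt (P.γ₀ * Y) with hA₀def
  set A₁ : ℝ := JAmp.ampConst (Fin 3) * Real.sqrt P.γ₀ * Y ^ 2 * Θ with hA₁def
  set A₂ : ℝ := JAmp.ampConst (Fin 3) * Real.sqrt P.γ₀ * Y ^ 4 * Θ ^ 2 with hA₂def
  set H₁ : ℝ := JAmp.ampConst (Fin 3) * P.γ₀ * Y ^ 2 * Θ with hH₁def
  set H₂ : ℝ := JAmp.ampConst (Fin 3) * P.γ₀ * Y ^ 4 * Θ ^ 2 with hH₂def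
  have hY0 : 0 ≤ Y := by linarith
  have hΘ0 : 0 ≤ Θ := by linarith
  have hγ0 : 0 ≤ P.γ₀ := hγ.le
  have hAmp : D.AmpBounds A₀ A₁ A₂ H₁ H₂ := by
    refine ⟨by positivity, by positivity, by positivity, by positivity, by positivity, ?_, ?_, ?_, ?_, ?_, ?_, ?_, ?_, ?_⟩
    · intro x t ht y
      have h0 := (hpack x ht y 0 0).1
      show |JAmp.jamp P.γ₀ M x t y| ≤ A₀
      rw [abs_of_nonneg h0.1]; exact h0.2
    · intro x t ht y l; exact (hpack x ht y l 0).2.1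
    · intro x t ht y; exact (hpack x ht y 0 0).2.2.1
    · intro x t ht y l m; exact (hpack x ht y l m).2.2.2.1
    · intro x t ht y l; exact (hpack x ht y l 0).2.2.2.2.1
    · intro x t ht y l; exact (hpack x ht y l 0).2.2.2.2.2.1
    · intro x t ht y; exact (hpack x ht y 0 0).2.2.2.2.2.2.1
    · intro x t ht y l m; exact (hpack x ht y l m).2.2.2.2.2.2.2.1
    · intro x t ht y l; exact (hpack x ht y l 0).2.2.2.2.2.2.2.2
  have hAmp0 : 0 ≤ A₀ := hAmp.hA₀
  -- auxiliary operator hypotheses in the required forms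
  have hC₂' : ∀ w : 𝕋³ → ℝ, Torus.IsSmooth w → ∀ j k : Fin 3,
      eLpNorm (Torus.partialDeriv j (Torus.partialDeriv k w)) 2 volume ≤ C₂ * eLpNorm (Torus.laplacian w) 2 volume := hC₂
  -- the new triple
  have hnew := Datum.isNSReynoldsOn_new hD (ν := ν) (v := vm) (P := pm) (Rc := Rc) hold hRc hRcsym
  have hvmS : Torus.IsSmoothSpaceTimeOn (Icc 0 P.T) vm := hold.smooth_velocity
  -- sizes at a fixed time
  have hfastF : ∀ x t y, Jet.fastF (D.J x) D.s x t y ≤ D.fastSup B := by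
    intro x t y
    obtain ⟨e0, -, -, p0, -⟩ := Datum.factor_sups hD hBD hB1 x t y 0
    have e1 : Jet.fastF (D.J x) D.s x t y = |Jet.eta (D.J x) x t y| ^ 2 * |Jet.psiJ (D.J x) D.s x y| ^ 2 := by rw [Jet.fastF, sq_abs, sq_abs]
    have hκ' : (D.κ ^ (1 / 2 : ℝ)) ^ 2 = D.κ := by
      rw [← Real.rpow_natCast, ← Real.rpow_mul (by show (0:ℝ) ≤ P.κ; linarith)]; norm_num
    rw [e1]
    calc |Jet.eta (D.J x) x t y| ^ 2 * |Jet.psiJ (D.J x) D.s x y| ^ 2 ≤ (B * D.κ ^ (1 / 2 : ℝ)) ^ 2 * (B * D.μ) ^ 2 :=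
          mul_le_mul (pow_le_pow_left₀ (abs_nonneg _) e0 2) (pow_le_pow_left₀ (abs_nonneg _) p0 2) (by positivity) (by positivity)
      _ = D.fastSup B := by rw [mul_pow, hκ', Datum.fastSup]; ring
  have hΦ : ∀ x t y, |Jet.fastF (D.J x) D.s x t y - 1| ≤ P.Φ c := by
    intro x t y
    have hf0 : 0 ≤ Jet.fastF (D.J x) D.s x t y := by unfold Jet.fastF; positivity
    have := hfastF x t y
    rw [abs_le]; constructor
    · show -(D.fastSup B + 1) ≤ _; linarith
    · show _ ≤ D.fastSup B + 1; linarith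
  -- the main estimates, one conjunct at a time
  refine ⟨fun t y => vm t y + D.w t y, _, _, hnew, ?_, ?_, ?_, ?_, ?_, ?_, ?_⟩
  · -- zero mean
    intro t ht
    show ∫ y, (vm t y + D.w t y) = 0
    rw [integral_add (hvmS.isSmooth_slice ht).integrable ((Datum.smooth_w hD).isSmooth_slice ht).integrable]
    have h1 : ∫ y, vm t y = 0 := hvmmean t ht
    have h2 : ∫ y, D.w t y = 0 := Datum.hasZeroMean_w hD ht
    rw [h1, h2, add_zero]
  · -- the L² increment
    intro t ht
    have hwp := Datum.isSmooth_wp hD ht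
    have hwr : Torus.IsSmooth (D.wr t) := (Datum.smooth_wr hD).isSmooth_slice ht
    have hEp : ∫ y, ‖D.wp t y‖ ^ 2 ≤ P.Ep c := by
      refine (Datum.integral_norm_wp_sq_le hD hAmp ht).trans ?_
      show NN * (5 * (2 / radius (Fin 3) * (D.γ₀ + 3 * ∫ y, ‖D.M t y‖) + 3 * H₁ * (Real.sqrt 3 / D.σ))) ≤
        NN * (5 * (2 / radius (Fin 3) * (P.γ₀ + 3 * (Cp * P.δ)) + 3 * H₁ * (Real.sqrt 3 / P.σ)))
      have hr := radius_pos Datum.hd3 (d := Fin 3)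
      have hN := one_le_NN
      have hMδ' : ∫ y, ‖D.M t y‖ ≤ Cp * P.δ := hMδ t
      have : D.γ₀ = P.γ₀ := rfl
      rw [this]
      have : (D.σ : ℝ) = P.σ := rfl
      rw [this]
      gcongr
    have hEr : ∫ y, ‖D.wr t y‖ ^ 2 ≤ P.Er c :=
      Datum.integral_norm_wr_sq_le hD ht (fun y => Datum.norm_wc_le_sup hD hBD hB1 hAmp ht y) (Datum.integral_norm_wc_le hD hBD hAmp ht)
        (Datum.integral_norm_X_sq_le hD hBD hB1 hAmp ht)
        (Datum.integral_norm_gradient_zeta_sq_le hD ht (by show 0 ≤ P.Z c; unfold StepPars.Z; positivity)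
          fun i => Datum.eLpNorm_partialDeriv_zeta_le hD hBD hB1 hAmp hC₂' ht i)
    have e : (fun y => vm t y + D.w t y) - v t = fun y => (vm t y - v t y) + D.wp t y + D.wr t y := by
      funext y; show vm t y + D.w t y - v t y = vm t y - v t y + D.wp t y + (D.w t y - D.wp t y); abel
    rw [e]
    have m1 : AEStronglyMeasurable (fun y => vm t y - v t y) volume :=
      ((hvmS.isSmooth_slice ht).sub (hns.smooth_velocity.isSmooth_slice ht)).continuous.aestronglyMeasurable
    have m2 : AEStronglyMeasurable (D.wp t) volume := hwp.continuous.aestronglyMeasurable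
    have m3 : AEStronglyMeasurable (D.wr t) volume := hwr.continuous.aestronglyMeasurable
    have hℓb : 0 ≤ Cp * (P.V + P.V) * P.ℓ := by positivity
    calc eLpNorm (fun y => vm t y - v t y + D.wp t y + D.wr t y) 2 volume
        ≤ eLpNorm (fun y => vm t y - v t y + D.wp t y) 2 volume + eLpNorm (D.wr t) 2 volume := eLpNorm_add_le (m1.add m2) m3 (by norm_num)
      _ ≤ (eLpNorm (fun y => vm t y - v t y) 2 volume + eLpNorm (D.wp t) 2 volume) + eLpNorm (D.wr t) 2 volume :=
          add_le_add (eLpNorm_add_le m1 m2 (by norm_num)) le_rfl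
      _ ≤ (ENNReal.ofReal (Cp * (P.V + P.V) * P.ℓ) + ENNReal.ofReal (Real.sqrt (P.Ep c))) + ENNReal.ofReal (Real.sqrt (P.Er c)) :=
          add_le_add (add_le_add (Torus.eLpNorm_le_of_forall_norm_le (fun y => hvmv t ht y) 2)
            (Torus.eLpNorm_two_le_ofReal_sqrt hwp.continuous hEp)) (Torus.eLpNorm_two_le_ofReal_sqrt hwr.continuous hEr)
      _ = ENNReal.ofReal (P.stepInc c) := by
          rw [← ENNReal.ofReal_add hℓb (Real.sqrt_nonneg _), ← ENNReal.ofReal_add (by positivity) (Real.sqrt_nonneg _)]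
          rfl
  · -- the L¹ stress bound
    intro t ht
    have iEp : ∫ y, ‖D.wp t y‖ ^ 2 ≤ P.Ep c := by
      refine (Datum.integral_norm_wp_sq_le hD hAmp ht).trans ?_
      show NN * (5 * (2 / radius (Fin 3) * (D.γ₀ + 3 * ∫ y, ‖D.M t y‖) + 3 * H₁ * (Real.sqrt 3 / D.σ))) ≤
        NN * (5 * (2 / radius (Fin 3) * (P.γ₀ + 3 * (Cp * P.δ)) + 3 * H₁ * (Real.sqrt 3 / P.σ)))
      have hr := radius_pos Datum.hd3 (d := Fin 3)
      have hN := one_le_NN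
      have hMδ' : ∫ y, ‖D.M t y‖ ≤ Cp * P.δ := hMδ t
      have : D.γ₀ = P.γ₀ := rfl
      rw [this]
      have : (D.σ : ℝ) = P.σ := rfl
      rw [this]
      gcongr
    have iLp : ∫ y, ‖D.wp t y‖ ≤ P.Lp c := Datum.integral_norm_wp_le hD hBD hAmp ht
    have iSc : ∀ y, ‖D.wpc t y - D.wp t y‖ ≤ P.Sc c := fun y => Datum.norm_wc_le_sup hD hBD hB1 hAmp ht y
    have iLc : ∫ y, ‖D.wpc t y - D.wp t y‖ ≤ P.Lc c := Datum.integral_norm_wc_le hD hBD hAmp ht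
    have iEX : ∫ y, ‖D.X t y‖ ^ 2 ≤ P.EX c := Datum.integral_norm_X_sq_le hD hBD hB1 hAmp ht
    have iEζ : ∫ y, ‖Torus.gradient (D.zeta t) y‖ ^ 2 ≤ P.Eζ c :=
      Datum.integral_norm_gradient_zeta_sq_le hD ht (by show 0 ≤ P.Z c; unfold StepPars.Z; positivity)
        fun i => Datum.eLpNorm_partialDeriv_zeta_le hD hBD hB1 hAmp hC₂' ht i
    have idW : ∀ i, ∫ y, ‖Torus.partialDeriv i (D.wpc t) y‖ ≤ P.LdW c := fun i => Datum.integral_norm_partialDeriv_wpc_le hD hAmp hBD ht i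
    have idX : ∀ i, ∫ y, ‖Torus.partialDeriv i (D.X t) y‖ ≤ P.LdX c := fun i => Datum.integral_norm_partialDeriv_X_le hD hAmp hBD hB1 ht i
    have iS : ∫ y, ‖D.Sosc t y‖ ≤ P.LS c := (Datum.integral_norm_Sosc_f₂_le hD hAmp hBD ht).1
    have if2 : ∫ y, ‖D.f₂ t y‖ ≤ P.Lf₂ c := (Datum.integral_norm_Sosc_f₂_le hD hAmp hBD ht).2
    have if3 : ∫ y, ‖D.f₃ t y‖ ≤ P.Lf₃ c := Datum.integral_norm_f₃_le hD hAmp ht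
    have if1 : ∫ y, ‖Torus.antidivergence (D.f₁ t) y‖ ≤ P.Lf₁ c :=
      (Datum.integral_norm_antidivergence_f₁_le hD hAmp hBD hB1 (p := 33 / 32) (by norm_num) (by norm_num) hCℛ ht).2
    have iV : ∀ y, ‖vm t y‖ ≤ Cp * P.V := fun y => hvm0 t y
    have iρ : ∀ y, ‖Rc t y‖ ≤ Cp * (P.V + 1 / P.T) * (P.V + P.V) * P.ℓ := fun y => hRcb t ht y
    have hLdW0 : 0 ≤ P.LdW c := (integral_nonneg fun y => norm_nonneg _).trans (idW 0)
    have hLdX0 : 0 ≤ P.LdX c := (integral_nonneg fun y => norm_nonneg _).trans (idX 0)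
    have h1 := Datum.integral_norm_newStress_le hD (ν := ν) hRc ht (hvmS.isSmooth_slice ht).continuous iV iρ iEp iLp iSc iLc iEX iEζ
      idW idX iS if2 if3 if1 hC₁
    refine h1.trans ?_
    have hν' : |ν| ≤ 1 := by rw [abs_of_pos hν]; exact hν1
    have hk : 4 * |ν| * (3 * (P.LdW c + P.LdX c)) ≤ 4 * (3 * (P.LdW c + P.LdX c)) := by
      have : 0 ≤ 3 * (P.LdW c + P.LdX c) := by positivity
      nlinarith [abs_nonneg ν]
    show _ ≤ 2 * (Cp * (P.V + 1 / P.T) * (P.V + P.V) * P.ℓ + (2 * (Real.sqrt (P.Ep c) * Real.sqrt (P.Er c)) + P.Er c) + P.LS c) +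
      4 * (Cp * P.V) * (P.Lp c + P.Lc c + Real.sqrt (P.EX c) + Real.sqrt (P.Eζ c)) + 4 * (3 * (P.LdW c + P.LdX c)) +
      (P.Lf₁ c + C₁ * (2 * (P.Lf₂ c + P.Lf₃ c)))
    have e1 : Real.sqrt (3 * (P.Sc c * P.Lc c + P.EX c + P.Eζ c)) = Real.sqrt (P.Er c) := rfl
    have e2 : (3 : ℝ) * (P.Sc c * P.Lc c + P.EX c + P.Eζ c) = P.Er c := rfl
    rw [e1, e2] at h1 ⊢
    linarith [hk]
  · -- the sup stress bound
    intro t ht y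
    have hwpc : Torus.IsSmooth (D.wpc t) := (Datum.smooth_wpc hD).isSmooth_slice ht
    have hX : Torus.IsSmooth (D.X t) := (Datum.smooth_X hD).isSmooth_slice ht
    have hSd : ∀ i y, ‖Torus.partialDeriv i (D.w' t) y‖ ≤ P.Sd c := by
      intro i y
      have e : Torus.partialDeriv i (D.w' t) y = Torus.partialDeriv i (D.wpc t) y + Torus.partialDeriv i (D.X t) y :=
        ((hwpc.hasDerivAt_line_zero i y).add (hX.hasDerivAt_line_zero i y)).deriv
      rw [e]
      exact (norm_add_le _ _).trans (add_le_add (Datum.norm_partialDeriv_wpc_le_sup hD hAmp hBD hB1 ht i y)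
        (Datum.norm_partialDeriv_X_le_sup hD hAmp hBD hB1 ht i y))
    have hpieces := fun z => Datum.norm_f₂_f₃_Sosc_le hD hAmp (K₁ := K₁) hK₁ ht (fun x z => hΦ x t z) z
    have hSf : ∀ z, ‖D.ffun t z‖ ≤ P.Sf c := by
      intro z
      have e : D.ffun t z = D.f₁ t z + D.f₂ t z + D.f₃ t z + D.f₄ t := rfl
      rw [e]
      have b1 : ‖D.f₁ t z‖ ≤ D.dtwpcSup A₀ A₁ A₂ B := Datum.norm_timeDerivWithin_wpc_le_sup hD hAmp hBD hB1 ht z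
      have b4 : ‖D.f₄ t‖ ≤ P.Lf₂ c + P.Lf₃ c :=
        (Datum.norm_f₄_le hD hRc ht).trans (add_le_add (Datum.integral_norm_Sosc_f₂_le hD hAmp hBD ht).2 (Datum.integral_norm_f₃_le hD hAmp ht))
      calc _ ≤ ‖D.f₁ t z‖ + ‖D.f₂ t z‖ + ‖D.f₃ t z‖ + ‖D.f₄ t‖ :=
            (norm_add_le _ _).trans (add_le_add ((norm_add_le _ _).trans (add_le_add (norm_add_le _ _) le_rfl)) le_rfl)
        _ ≤ D.dtwpcSup A₀ A₁ A₂ B + NN * ((2 * 3 + 1) * (27 * H₂) * (3 * ((K₁ : ℝ) * P.Φ c))) +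
            NN * (3 * D.mup⁻¹ * (H₁ * (P.Φ c + 1))) + (P.Lf₂ c + P.Lf₃ c) :=
            add_le_add (add_le_add (add_le_add b1 (hpieces z).1) (hpieces z).2.1) b4
        _ = P.Sf c := rfl
    have iV : ∀ z, ‖vm t z‖ ≤ Cp * P.V := fun z => hvm0 t z
    have iρ : ∀ z, ‖Rc t z‖ ≤ Cp * (P.V + 1 / P.T) * (P.V + P.V) * P.ℓ := fun z => hRcb t ht z
    have iSw : ∀ z, ‖D.w t z‖ ≤ P.Sw c := fun z => Datum.norm_w_le_sup hD hAmp hBD hB1 (K := K) hK ht z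
    have iSp : ∀ z, ‖D.wp t z‖ ≤ P.Sp c := fun z => Datum.norm_wp_le_sup hD hBD hB1 hAmp ht z
    have iSS : ∀ z, ‖D.Sosc t z‖ ≤ P.SS c := fun z => (hpieces z).2.2
    have h1 := Datum.norm_newStress_le_sup hD (ν := ν) ht iV iρ iSw iSp hSd iSS hSf (fun g hg C hC hb z => hKℛ g hg C hC hb z) y
    refine h1.trans ?_
    have hν' : |ν| ≤ 1 := by rw [abs_of_pos hν]; exact hν1
    have hSd0 : 0 ≤ P.Sd c := (norm_nonneg _).trans (hSd 0 y)
    have hk : 4 * |ν| * (3 * P.Sd c) ≤ 4 * (3 * P.Sd c) := by nlinarith [abs_nonneg ν]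
    show _ ≤ 2 * (Cp * (P.V + 1 / P.T) * (P.V + P.V) * P.ℓ + (2 * (P.Sp c * (P.Sw c + P.Sp c)) + (P.Sw c + P.Sp c) ^ 2) + P.SS c) +
      4 * (Cp * P.V * P.Sw c) + 4 * (3 * P.Sd c) + Kℛ * P.Sf c
    linarith [hk]
  · -- sup of v'
    intro t ht y
    exact (norm_add_le _ _).trans (add_le_add (hvm0 t y) (Datum.norm_w_le_sup hD hAmp hBD hB1 (K := K) hK ht y))
  · -- sup of ∂ᵢ v'
    intro t ht y i
    have e : Torus.partialDeriv i (fun y => vm t y + D.w t y) y = Torus.partialDeriv i (vm t) y + Torus.partialDeriv i (D.w t) y :=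
      (((hvmS.isSmooth_slice ht).hasDerivAt_line_zero i y).add (((Datum.smooth_w hD).isSmooth_slice ht).hasDerivAt_line_zero i y)).deriv
    rw [e]
    exact (norm_add_le _ _).trans (add_le_add (hvm1 t ht y i) (Datum.norm_partialDeriv_w_le_sup hD hAmp hBD hB1 hCψD (K := K) hK ht i y))
  · -- sup of ∂ₜ v'
    intro t ht y
    have key := (hvmS.hasDerivWithinAt_slice ht y).add ((Datum.smooth_w hD).hasDerivWithinAt_slice ht y)
    have e : Torus.timeDerivWithin (Icc 0 P.T) (fun t y => vm t y + D.w t y) t y =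
        Torus.timeDerivWithin (Icc 0 P.T) vm t y + Torus.timeDerivWithin (Icc 0 P.T) D.w t y := key.derivWithin (Datum.uniqueDiffOn hD t ht)
    rw [e]
    exact (norm_add_le _ _).trans (add_le_add (hvmt t ht y) (Datum.norm_timeDerivWithin_w_le_sup hD hAmp hBD hB1 (K₁ := K₁) hK₁ ht y))

end JetStep

end Literature.Analysis.FluidPDE
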